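import Literature.Probability.Process.PoissonCloudConstruction
import Literature.Probability.Process.PoissonCloud
import Mathlib.MeasureTheory.Measure.Typeclasses.SFinite
import HarnessLib

/-!
# Kingman's Existence Theorem for Poisson processes (proof of `exists_isPoissonCloud`)

J. F. C. Kingman, *Poisson Processes* (Oxford, 1993), §2.5, p. 23:

> **Existence Theorem.** Let `μ` be a non-atomic measure on `S` which can be expressed in the
> form `μ = Σₙ μₙ`, `μₙ(S) < ∞`. Then there exists a Poisson process on `S` having `μ` as its mean
> measure.

This file completes the proof for the construction `KingmanCloud.cloud` of
`PoissonCloudConstruction` and discharges the named fact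
`Literature.Probability.Process.exists_isPoissonCloud` (file `PoissonCloud`):

* `measurable_encard_cloud_inter` — the counts `N(s) = #(Π ∩ s)` are random variables (this is
  where Kingman's standing assumption that the diagonal of `S × S` is measurable (§2.1, p. 11)
  enters: `#(Π ∩ s)` is the number of `encode`-minimal indices among those of points in `s`);
* `measure_not_injOn` — "if `p` has no atoms the `X_r` are distinct with probability one (the
  formal proof is a simpler version of that of the Disjointness Lemma)" (§2.4, p. 22; §2.2,
  p. 14): almost surely no two marks `X_{i,k}`, `X_{i',k'}` of points of the construction
  coincide, so that `N(s) = #idx s = Σ_i N_i(s)` a.s. (Kingman (2.21));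
* `isPoissonCloud_cloud` — the construction is a Poisson process with mean measure
  `Σ_n m_n ρ_n` (superposition, file `PoissonCloudConstruction`);
* `exists_isPoissonCloud_holds` — the Existence Theorem: write the s-finite `Λ` as `Σₙ μₙ`
  (`sfiniteSeq`), `μₙ = cₙ νₙ` with `cₙ = μₙ(E)` and `νₙ = μₙ/cₙ` (any probability law if
  `cₙ = 0`; Kingman: "without loss of generality `μₙ(S) > 0`"), and apply the above with `ι = ℕ`
  (`ι = ∅` if `E` is empty).
-/

noncomputable section

open MeasureTheory ProbabilityTheory Set Filter
open scoped ENNReal NNReal Topology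

namespace Literature.Probability.Process

open Literature.Probability.Distributions

namespace KingmanCloud

variable {E : Type*} [MeasurableSpace E] (m : ℕ → ℝ≥0) (ρ : ℕ → Measure E)
  [∀ n, IsProbabilityMeasure (ρ n)]

/-! ### The counts `N(s) = #(Π ∩ s)` are random variables -/

omit [∀ n, IsProbabilityMeasure (ρ n)] in
/-- The coincidence events `{X_b = X_a}` are measurable when the diagonal is.
[cite: Kingman1993, §2.1 (2.2), p. 11] -/
theorem measurableSet_mark_eq (hdiag : MeasurableSet (diagonal E)) (a b : ℕ × ℕ) :
    MeasurableSet {ω : ℕ → ℕ × (ℕ → E) | mark ω b = mark ω a} :=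
  hdiag.preimage ((measurable_mark b).prodMk (measurable_mark a))

omit [∀ n, IsProbabilityMeasure (ρ n)] in
/-- **The counts are random variables**: for measurable `s`, `ω ↦ #(Π(ω) ∩ s) ∈ ℕ∞` is measurable
(it is the number of `encode`-minimal indices of points in `s`, a countable Boolean combination
of the events `{(i,k) ∈ idx s}` and `{X_a = X_b}`). [cite: Kingman1993, §2.1 (2.1)–(2.2), p. 11] -/
theorem measurable_encard_cloud_inter (hdiag : MeasurableSet (diagonal E)) {s : Set E}
    (hs : MeasurableSet s) :
    Measurable fun ω : ℕ → ℕ × (ℕ → E) ↦ (cloud ω ∩ s).encard := by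
  classical
  letI : Encodable (ℕ × ℕ) := Encodable.ofCountable _
  have heq : (fun ω : ℕ → ℕ × (ℕ → E) ↦ (cloud ω ∩ s).encard) = fun ω ↦
      (minRep (mark ω) (idx s ω)).encard := by
    funext ω
    rw [cloud_inter_eq_image, encard_image_eq_encard_minRep]
  rw [heq]
  refine measurable_encard.comp (measurable_set_iff.2 fun a ↦ measurableSet_setOf.1 ?_)
  have hset : {ω : ℕ → ℕ × (ℕ → E) | a ∈ minRep (mark ω) (idx s ω)} =
      {ω | a ∈ idx s ω} ∩ ⋂ b : ℕ × ℕ, {ω | b ∈ idx s ω →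
        mark ω b = mark ω a → Encodable.encode a ≤ Encodable.encode b} := by
    ext ω
    simp only [minRep, mem_setOf_eq, mem_inter_iff, mem_iInter]
  rw [hset]
  refine (measurableSet_mem_idx hs a).inter (MeasurableSet.iInter fun b ↦ ?_)
  by_cases hR : Encodable.encode a ≤ Encodable.encode b
  · simp [hR]
  · have : {ω : ℕ → ℕ × (ℕ → E) | b ∈ idx s ω →
        mark ω b = mark ω a → Encodable.encode a ≤ Encodable.encode b} =
        ({ω | b ∈ idx s ω} ∩ {ω | mark ω b = mark ω a})ᶜ := by
      ext ω
      simp only [hR, imp_false, mem_setOf_eq, mem_compl_iff, mem_inter_iff, not_and]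
    rw [this]
    exact ((measurableSet_mem_idx hs b).inter (measurableSet_mark_eq hdiag a b)).compl

/-! ### The points are almost surely distinct -/

/-- Two distinct indices carry the same point with probability `0`: either the batch of `b` is
a.s. empty (`c = 0`, `N ~ 𝒫(0) = δ₀`), or `ν_{b}` has no atoms and
`P{X_a = X_b} = (ν_a ⊗ ν_b)(diagonal) = ∫ ν_b{x} ν_a(dx) = 0` (Fubini, as in the Disjointness Lemma).
[cite: Kingman1993, §2.2 Disjointness Lemma, p. 14] -/
theorem measure_collision_eq_zero (hdiag : MeasurableSet (diagonal E))
    (hatom : ∀ i x, m i = 0 ∨ ρ i {x} = 0) {a b : ℕ × ℕ} (hab : a ≠ b) :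
    cloudMeasure m ρ {ω | b ∈ idx univ ω ∧ mark ω a = mark ω b} = 0 := by
  by_cases hcb : m b.1 = 0
  · -- the batch of `b` is almost surely empty
    refine measure_mono_null (t := {ω | b.2 < (ω b.1).1}) (fun ω hω ↦ hω.1.1) ?_
    have hK := hasLaw_fst_eval m ρ b.1
    rw [hcb, poissonMeasure_zero] at hK
    rw [measure_eq_zero_iff_ae_notMem]
    filter_upwards [hK.ae_eq_of_dirac] with ω hω
    simp [hω]
  · -- `ν_{b}` has no atoms
    have hνb : ∀ x, ρ b.1 {x} = 0 := fun x ↦ (hatom b.1 x).resolve_left hcb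
    refine measure_mono_null (t := {ω | mark ω a = mark ω b}) (fun ω hω ↦ hω.2) ?_
    have hpair : HasLaw (fun ω : ℕ → ℕ × (ℕ → E) ↦ (mark ω a, mark ω b)) ((ρ a.1).prod (ρ b.1))
        (cloudMeasure m ρ) := by
      have h2 : HasLaw (fun x : ℕ × ℕ → E ↦ (x a, x b)) ((ρ a.1).prod (ρ b.1))
          (Measure.infinitePi fun p : ℕ × ℕ ↦ ρ p.1) :=
        ⟨by fun_prop, Measure.infinitePi_map_eval_prod hab⟩
      exact h2.comp (hasLaw_mark m ρ)
    change cloudMeasure m ρ ((fun ω ↦ (mark ω a, mark ω b)) ⁻¹' diagonal E) = 0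
    rw [← Measure.map_apply (by fun_prop) hdiag, hpair.map_eq, Measure.prod_apply hdiag]
    have hfib : ∀ x : E, Prod.mk x ⁻¹' diagonal E = {x} := fun x ↦ by
      ext y
      simp [eq_comm]
    simp [hfib, hνb]

/-- **The points of the construction are almost surely distinct** ("the `X_r` are distinct with
probability one"; Disjointness Lemma for the batches): the mark map `(i, k) ↦ X_{i,k}` is a.s.
injective on the active indices `k < N_i`. [cite: Kingman1993, §2.4, p. 22] -/
theorem measure_not_injOn (hdiag : MeasurableSet (diagonal E))
    (hatom : ∀ i x, m i = 0 ∨ ρ i {x} = 0) :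
    cloudMeasure m ρ {ω | ¬ InjOn (mark ω) (idx univ ω)} = 0 := by
  have hsub : {ω : ℕ → ℕ × (ℕ → E) | ¬ InjOn (mark ω) (idx univ ω)} ⊆
      ⋃ a : ℕ × ℕ, ⋃ b : ℕ × ℕ, ⋃ (_ : a ≠ b), {ω | b ∈ idx univ ω ∧ mark ω a = mark ω b} := by
    intro ω hω
    simp only [InjOn, not_forall, exists_prop] at hω
    obtain ⟨a, -, b, hb, h, hne⟩ := hω
    simp only [mem_iUnion, mem_setOf_eq, exists_prop]
    exact ⟨a, b, hne, hb, h⟩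
  refine measure_mono_null hsub (measure_iUnion_null_iff.2 fun a ↦ measure_iUnion_null_iff.2
    fun b ↦ measure_iUnion_null_iff.2 fun hab ↦ measure_collision_eq_zero m ρ hdiag hatom hab)

/-- Consequently `N(s) = #(Π ∩ s)` equals the multiplicity count `#idx s = Σ_i N_i(s)` for all `s`,
almost surely (Kingman (2.21): "the random sets `Πₙ` are disjoint on `A`, so that the number of
points of `Π` in `A` is `N(A) = Σ Nₙ(A)`"). [cite: Kingman1993, §2.2 (2.21), p. 16] -/
theorem encard_cloud_inter_ae_eq (hdiag : MeasurableSet (diagonal E))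
    (hatom : ∀ i x, m i = 0 ∨ ρ i {x} = 0) :
    ∀ᵐ ω ∂cloudMeasure m ρ, ∀ s : Set E, (cloud ω ∩ s).encard = (idx s ω).encard := by
  have h : ∀ᵐ ω ∂cloudMeasure m ρ, InjOn (mark ω) (idx univ ω) := by
    rw [ae_iff]
    exact measure_not_injOn m ρ hdiag hatom
  filter_upwards [h] with ω hω s
  rw [cloud_inter_eq_image, (hω.mono (idx_mono (subset_univ s) ω)).encard_image]

/-! ### The construction is a Poisson process -/

/-- **Kingman's construction is a Poisson process**: if `Λ(s) = Σ_n m_n ρ_n(s)` on measurable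
sets, each `m_n ρ_n` has no atoms, and the diagonal of `E` is measurable, then the random
countable set `Π = ⋃_i {X_{i,k} | k < N_i}` under `cloudMeasure m ρ` is a Poisson process with
mean measure `Λ` in the sense of `IsPoissonCloud`.
[cite: Kingman1993, §2.5 Existence Theorem (proof), pp. 23–24] -/
theorem isPoissonCloud_cloud {Λ : Measure E} (hdiag : MeasurableSet (diagonal E))
    (hΛ : ∀ s, MeasurableSet s → Λ s = ∑' n, (m n : ℝ≥0∞) * ρ n s)
    (hatom : ∀ n x, m n = 0 ∨ ρ n {x} = 0) :
    IsPoissonCloud Λ (cloud (E := E)) (cloudMeasure m ρ) := by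
  have hae := encard_cloud_inter_ae_eq m ρ hdiag hatom
  have hmean : ∀ s, MeasurableSet s →
      (∑' n, ((m n * (ρ n s).toNNReal : ℝ≥0) : ℝ≥0∞)) = Λ s := fun s hs ↦ by
    rw [hΛ s hs]
    refine tsum_congr fun n ↦ ?_
    rw [ENNReal.coe_mul, ENNReal.coe_toNNReal (measure_ne_top _ _)]
  have hlaw : ∀ s, MeasurableSet s →
      HasLaw (fun ω ↦ (cloud ω ∩ s).encard) (extPoissonMeasure (Λ s)) (cloudMeasure m ρ) :=
    fun s hs ↦ by
    rw [← hmean s hs]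
    exact (hasLaw_encard_idx m ρ hs).congr (hae.mono fun ω hω ↦ hω s)
  refine ⟨inferInstance, countable_cloud, fun s hs ↦ measurable_encard_cloud_inter hdiag hs,
    fun s hs hfin ↦ ?_, fun s hs hinf ↦ ?_, fun n t ht hdisj ↦ ?_⟩
  · rw [(hlaw s hs).map_eq, extPoissonMeasure_of_ne_top hfin]
  · have h := hlaw s hs
    rw [hinf, extPoissonMeasure_top] at h
    exact h.ae_eq_of_dirac
  · exact (iIndepFun_congr fun j ↦ hae.mono fun ω hω ↦ (hω (t j)).symm).1
      (iIndepFun_encard_idx m ρ ht hdisj)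

end KingmanCloud

/-! ### The degenerate case of an empty state space -/

/-- On an EMPTY state space every measure is `0` and the empty random set (on a one-point
probability space) is a Poisson process with that mean measure: all counts vanish, `𝒫(0) = δ₀`.
[cite: Kingman1993, §2.1, p. 11] -/
theorem isPoissonCloud_of_isEmpty {E : Type*} [MeasurableSpace E] [IsEmpty E] (Λ : Measure E) :
    IsPoissonCloud Λ (fun _ : PUnit ↦ (∅ : Set E)) (Measure.dirac PUnit.unit) := by
  have hΛ : ∀ s : Set E, Λ s = 0 := fun s ↦ by rw [Set.eq_empty_of_isEmpty s, measure_empty]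
  refine ⟨inferInstance, fun _ ↦ countable_empty, fun s _ ↦ measurable_const, fun s _ _ ↦ ?_,
    fun s _ h ↦ absurd (hΛ s) (h ▸ ENNReal.top_ne_zero), fun n t _ _ ↦ ?_⟩
  · rw [hΛ s, ENNReal.toNNReal_zero, poissonMeasure_zero, Measure.map_dirac' measurable_from_top,
      Measure.map_dirac' measurable_from_top]
    simp
  · rw [iIndepFun_iff_map_fun_eq_pi_map fun i ↦ aemeasurable_const]
    simp only [empty_inter, encard_empty, Measure.map_const, measure_univ, one_smul]
    rw [← Measure.infinitePi_eq_pi, Measure.infinitePi_dirac]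

/-! ### The Existence Theorem -/

/-- **Kingman's Existence Theorem** (discharge of the named fact `exists_isPoissonCloud`): on a
measurable space whose diagonal is measurable, every s-finite measure without atoms is the mean
measure of a Poisson process (random countable set with independent Poisson counts). Proof:
`Λ = Σₙ μₙ` with `μₙ` finite (`sfiniteSeq`); `μₙ = cₙ νₙ`, `cₙ = μₙ(E)`, `νₙ = μₙ/cₙ` a
probability law without atoms when `cₙ ≠ 0`; apply `KingmanCloud.isPoissonCloud_cloud`.
[cite: Kingman1993, §2.5 Existence Theorem, p. 23] -/
theorem exists_isPoissonCloud_holds : exists_isPoissonCloud := by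
  intro E _ Λ hdiag hsf hΛ0
  rcases isEmpty_or_nonempty E with hE | ⟨⟨x₀⟩⟩
  · exact ⟨PUnit, inferInstance, Measure.dirac PUnit.unit, fun _ ↦ ∅, isPoissonCloud_of_isEmpty Λ⟩
  · let μ : ℕ → Measure E := sfiniteSeq Λ
    let m : ℕ → ℝ≥0 := fun n ↦ (μ n univ).toNNReal
    let ρ : ℕ → Measure E := fun n ↦ if μ n univ = 0 then Measure.dirac x₀ else (μ n univ)⁻¹ • μ n
    haveI hρ : ∀ n, IsProbabilityMeasure (ρ n) := fun n ↦ by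
      by_cases h : μ n univ = 0
      · simp only [ρ, h, if_true]
        infer_instance
      · simp only [ρ, h, if_false]
        exact ⟨by simp [ENNReal.inv_mul_cancel h (measure_ne_top _ _)]⟩
    refine ⟨ℕ → ℕ × (ℕ → E), inferInstance, cloudMeasure m ρ, KingmanCloud.cloud,
      KingmanCloud.isPoissonCloud_cloud m ρ hdiag (fun s hs ↦ ?_) fun n x ↦ ?_⟩
    · conv_lhs => rw [← sum_sfiniteSeq Λ, Measure.sum_apply _ hs]
      refine tsum_congr fun n ↦ ?_
      by_cases h : μ n univ = 0
      · have h0 : μ n s = 0 := measure_mono_null (subset_univ _) h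
        simp [m, ρ, μ, h, h0]
      · simp only [m, ρ, h, if_false, Measure.smul_apply, smul_eq_mul]
        rw [ENNReal.coe_toNNReal (measure_ne_top _ _), ← mul_assoc,
          ENNReal.mul_inv_cancel h (measure_ne_top _ _), one_mul]
    · by_cases h : μ n univ = 0
      · left
        simp [m, h]
      · right
        simp only [ρ, h, if_false, Measure.smul_apply, smul_eq_mul]
        have hx : μ n {x} = 0 :=
          le_antisymm ((Measure.le_iff'.1 (sfiniteSeq_le Λ n) {x}).trans (hΛ0 x).le) bot_le
        simp [hx]

end Literature.Probability.Process
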